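import Summits.Parity.GeneralizedHardyLittlewood.Theses.LeeYangFibres
import Summits.Parity.GeneralizedHardyLittlewood.Theorems.LeeYangFibresRelativeDimOneDefs
import Summits.Parity.GeneralizedHardyLittlewood.Theorems.LeeYangFibresRelativeDimOneTightness
import Summits.Parity.GeneralizedHardyLittlewood.Theorems.LeeYangFibresRelativeDimOneEquivalence
import Summits.Parity.GeneralizedHardyLittlewood.Theorems.LeeYangFibresRelativeDimOneNecessityDefs
import Summits.Parity.GeneralizedHardyLittlewood.Theorems.LeeYangFibresRelativeDimOneUpperAmplification
import Summits.Parity.GeneralizedHardyLittlewood.Theorems.LeeYangFibresRelativeDimOneHardness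
import Summits.Parity.GeneralizedHardyLittlewood.Theorems.LeeYangFibresRelativeDimOne
import Summits.Parity.GeneralizedHardyLittlewood.Theorems.LeeYangFibresCellParityLawSingularRatio
import HarnessLib

/-!
# Line `translate-amplification` — skeleton for the crux `RelativeDimOne` (stmt-Parity-14113),
# DECOUPLED form: the atom split into its two independently-amplifiable halves

Route `LeeYangFibres` (Parity / GeneralizedHardyLittlewood); crux decl
`Summit.Parity.GeneralizedHardyLittlewood.Theses.LeeYangFibres.RelativeDimOne` (rank 9; the `Λ`-form of
Green–Tao Conj. 1.4 at `d = 1`, uniform over non-degenerate `t`-systems `Ψ` with `‖Ψ‖_N ≤ L` and convex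
`K ⊆ [-N, N]`, error `ε (β_∞𝔖 + N)`). Idea card `Cruxes/RelativeDimOne/Ideas/translate-amplification.md`
(crux-ideate r1, triage r1: pass ×2); crux-plan seat `planner-cruxplan-stmt-Parity-14113-translate-amplificat-0`.

## Where the line stands (everything cited is kernel-checked in the tree)

The lead built this idea as `Lines/SketchIdeator1.lean` (same namespace) and landed ALL its provable stubs:
the m-fold complete-sum identity `∑_{H ∈ [-2N,2N]^m} S(Ψ^{(H)}, K_H) = S(Ψ,K)^{m+1}` (`completeSum`, p86258),
Gallagher averaging of the singular data of translate-constellations (`singularMean`, p90896 over p87792,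
p88485, p87682, p89974, p90745), the transfer (`stub_amplification`, p90024) and tightness (p86661), whence
**`relativeDimOne_iff_coarseHLSlack : RelativeDimOne ↔ CoarseHLSlack`** (p90896): the crux is EQUIVALENT to
coarse two-sided Hardy–Littlewood bounds `e^{-g(T)} β_∞𝔖 − ηN ≤ S ≤ e^{g(T)} β_∞𝔖 + ηN` with ANY loss
`g(T) = o(T)` in the number of forms ("sharpness is free"). That skeleton is closed modulo ONE stub, the
atom `CoarseHLSlack`, which restates the crux up to p90896 — so it cannot be re-registered as a line
(one stub; costume).

## This skeleton: the card's DECOUPLING (Transfer, why-easier (ii)) made into registered stubs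

The two halves of the atom amplify INDEPENDENTLY over translate-constellations (the complete sum is an
identity, so each one-sided coarse bound transfers on its own):

* `stub_coarseUpperHLSlack : CoarseUpperHLSlack` — ATOM U (typed in `…NecessityDefs`, p91813): coarse UPPER
  bounds `S ≤ e^{g(T)} β_∞𝔖 + ηN`, `g = o(T)`. OPEN. Certificate: `uniformCharPNT_of_coarseUpperHLSlack`
  (p92834) — U alone forces `ψ(N,χ) = o(N)` for every non-principal `χ` of conductor `≤ N^θ`, `θ < 1`
  (GRH-lite; bounded Siegel quality). Barrier profile: SelbergParity / SignGhost (Type-I methods give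
  `g(T) ≥ T log 2`: the known rung is `2^T T!`), SiegelZero via p92834.
* `stub_coarseLowerHLSlack : CoarseLowerHLSlack` — ATOM L (typed here): coarse LOWER bounds
  `e^{-g(T)} β_∞𝔖 ≤ S + ηN`, `g = o(T)`. OPEN; the HARDEST stub: its `T = 2` instance `(n, n+2)` is the
  twin prime conjecture with the right order, and no engine outputs `T` primes out of `T` forms
  (MaynardFunctionalCeiling / WeightedSieveLimit bite: `m ≍ log T` of `T`).
* `stub_lowerAmplification : CoarseLowerHLSlack → LowerRelativeDimOne` — PROVABLE NOW (M): the lower-half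
  mirror of the landed `upperRelativeDimOne_of_coarseUpperHLSlack` (p92176), and simpler — degenerate
  shifts are DROPPED by positivity (`S_H ≥ 0`, no `DegenerateCount` on this side) and the low-mass regime
  `β_∞𝔖 < κN` is trivial (`S ≥ 0 ≥ (1−ε)β_∞𝔖 − εN` once `κ ≤ ε`); high mass: `S^{m+1} = ∑_H S_H ≥
  ∑_{nondeg} S_H ≥ e^{-g(T)} ∑_{nondeg} M_H − 5^m N^m η'N ≥ ((1 − e/2) M)^{m+1}` by `completeSum`,
  `singularMean`, `lower_ratio`, `sum_filter_lower` (`…AmplificationAux`), then `(m+1)`-th roots.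
* `RelativeDimOne_of : RelativeDimOne` — REAL PROOF below over the three stub theorems (the only crux-concluding
  declaration of the file, as the skeleton audit requires; its arrow form `CoarseUpperHLSlack →
  CoarseLowerHLSlack → (CoarseLowerHLSlack → LowerRelativeDimOne) → RelativeDimOne` is the `example` after it):
  upper half by p92176, lower half by the third stub, halves glued by `relativeDimOne_iff_halves`.

Sorry-free bookkeeping below certifies that the split is LOSSLESS: `coarseHLSlack_iff_halves :
CoarseHLSlack ↔ (CoarseUpperHLSlack ∧ CoarseLowerHLSlack)` (so U ∧ L is exactly the old atom, hence
exactly the crux), `relativeDimOne_iff_halves`, and the tightness of each half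
(`coarseLowerHLSlack_of_lowerRelativeDimOne`, `coarseUpperHLSlack_of_upperRelativeDimOne`: each half of
the crux is equivalent to the corresponding coarse half once the two amplifications are in — for L this
waits on `stub_lowerAmplification`).

Disproof.lean for this crux (`Cruxes/RelativeDimOne/Disproof.lean`, cdisprove cycle 1, landed 2026-08-16T09:31Z
while this skeleton was being registered; VERDICT: no kill, no mis-statement) — READ and honoured:
* §A `relativeDimOne_false_without_size | _box | _convex | _nondegenerate | _epsPos | _threshold`: every
  hypothesis of the crux except `1 ≤ t` is load-bearing. BOTH atom stubs keep every one of them verbatim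
  (`affLinSize Φ N ≤ L`, `K ⊆ realBox 1 N`, `Convex ℝ K`, `IsNondegenerateSystem Φ`, `0 < η`, `∃ N₀` after
  `T, L, η`), and `stub_lowerAmplification` is exactly where the line USES them: L is applied to the
  translate-constellations `Ψ^{(H)}` through `affLinSize_translateFamily_le` (size `(3m+1)L` — H = size),
  `convex_meetTranslates` (H = convex), `meetTranslates_subset` (H = box) and only on NON-DEGENERATE shifts
  (H = nondegenerate; the degenerate ones are dropped by positivity).
* §B `not_purelyRelativeDimOne` (drop `+ εN`: FALSE, short bodies carry no primes) — both atoms keep the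
  `+ ηN` slack (a slack-free coarse bound `e^{-g}β_∞𝔖 ≤ S` dies on the same unit-segment witness);
  `not_relativeDimOneUniformInSize` (`N₀` uniform in `L`: FALSE) — both atoms quantify `∀ T L … ∃ N₀`.
* §C `relativeDimOneAtZero_holds`, `relativeDimOneAtOne_holds`: the `t = 0, 1` slices are THEOREMS — so are
  the `T = 1` slices of U and L (the tightness proofs `coarse…_of_…RelativeDimOne` run slice-wise); the content
  of L starts at `T = 2` (twin primes), while EVERY fixed-`T` slice of U with SOME finite loss is a classical
  sieve theorem (pairs: constant 4, `Literature.NumberTheory.Sieve.twinSieveUpperBound_four`; `T`-tuples: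
  `2^T T!`) — U's content is the growth `g(T) = o(T)`, equivalently (p92176) the sharp constant `1 + ε` at
  every `T`.
* "WHY IT RESISTS (iv)": the only disproof route in print runs through a Siegel zero —
  `Theorems/LeeYangFibresAbsoluteUpgradeIllusory.not_relativeDimOne_of_unboundedSiegelZeros`
  (`UnboundedSiegelZeros ∧ MatomakiMerikoski2023_pairCorrelation → ¬RelativeDimOne`): a Siegel zero DOUBLES
  the pair count at resonant shifts, i.e. it breaks the UPPER atom U (consistent with
  `uniformCharPNT_of_coarseUpperHLSlack`, p92834), not L — the split localises the Siegel sensitivity in U.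
* `-- Targets`: none (no stub kill recorded). Landed Negative lemmas for this crux: none
  (no `Theorems/RelativeDimOne/Negative/`). Negatives index (stmt-Parity-9541, 14832, 4218): no stub is an
  instance or a rewording.
-/

noncomputable section

open scoped BigOperators Classical Topology
open Finset Filter MeasureTheory Literature.NumberTheory.Sieve
open Summit.Parity.GeneralizedHardyLittlewood.Theses.LeeYangFibres (RelativeDimOne)
open Summit.Parity.GeneralizedHardyLittlewood.Cruxes.RelativeDimOne.GallagherBackwards
  (CoarseUpperHLSlack UpperRelativeDimOne UniformCharPNT upperRelativeDimOne_of_coarseUpperHLSlack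
    uniformCharPNT_of_coarseUpperHLSlack coarseUpperHLSlack_of_coarseHLSlack
    upperRelativeDimOne_of_relativeDimOne)

namespace Summit.Parity.GeneralizedHardyLittlewood.Cruxes.RelativeDimOne.TranslateAmplification

/-! ### Vocabulary of the decoupled line: the LOWER halves (the upper halves are in `…NecessityDefs`) -/

/-- ATOM L — the LOWER HALF of the atom `CoarseHLSlack`: coarse lower bounds
`e^{-g(T)} β_∞𝔖 ≤ S(Φ,K) + ηN` for prime constellations with sub-exponential loss `g(T) = o(T)` in the
number of forms and `o(N)` slack, uniformly over non-degenerate `T`-systems of size `≤ L` and convex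
`K ⊆ [-N, N]` (the exact mirror of `GallagherBackwards.CoarseUpperHLSlack`). Open-problem strength: at
`T = 2`, `Φ = (n, n+2)` it is the twin prime conjecture with the right order of magnitude. -/
def CoarseLowerHLSlack : Prop :=
  ∃ g : ℕ → ℝ, Tendsto (fun T : ℕ => g T / T) atTop (𝓝 0) ∧
    ∀ (T L : ℕ), 1 ≤ T → ∀ η : ℝ, 0 < η → ∃ N₀ : ℕ, ∀ N : ℕ, N₀ ≤ N →
      ∀ Φ : Fin T → AffLinForm 1, IsNondegenerateSystem Φ → affLinSize Φ N ≤ L →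
        ∀ K : Set (Fin 1 → ℝ), Convex ℝ K → K ⊆ realBox 1 N →
          Real.exp (-g T) * (archFactor Φ K * singularProduct Φ) ≤ vonMangoldtSum Φ K N + η * N

/-- The LOWER HALF of the crux `RelativeDimOne`: `(1 − ε) β_∞𝔖 ≤ S(Ψ,K) + εN` uniformly (the mirror
of `GallagherBackwards.UpperRelativeDimOne`; `RelativeDimOne ↔ Upper ∧ Lower`,
`relativeDimOne_iff_halves`). -/
def LowerRelativeDimOne : Prop :=
  ∀ (t L : ℕ), 1 ≤ t → ∀ ε : ℝ, 0 < ε → ∃ N₀ : ℕ, ∀ N : ℕ, N₀ ≤ N →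
    ∀ Ψ : Fin t → AffLinForm 1, IsNondegenerateSystem Ψ → affLinSize Ψ N ≤ L →
      ∀ K : Set (Fin 1 → ℝ), Convex ℝ K → K ⊆ realBox 1 N →
        (1 - ε) * (archFactor Ψ K * singularProduct Ψ) ≤ vonMangoldtSum Ψ K N + ε * N

/-! ### Registered stubs -/

/-- Stub ATOM U (registered; OPEN, `UniformCharPNT`-hard by p92834): coarse UPPER bounds for prime
constellations with sub-exponential dimension loss and `o(N)` slack. -/
theorem stub_coarseUpperHLSlack : CoarseUpperHLSlack := by
  sorry

/-- Stub ATOM L (registered; OPEN, the hardest: contains prime `T`-tuples with the right order for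
every `T`): coarse LOWER bounds for prime constellations with sub-exponential dimension loss and `o(N)`
slack. -/
theorem stub_coarseLowerHLSlack : CoarseLowerHLSlack := by
  sorry

/-- Stub LOWER-HALF AMPLIFICATION (registered; PROVABLE NOW, M-sized): coarse lower bounds with ANY loss
`g(T) = o(T)` already give the SHARP lower bound `(1−ε) β_∞𝔖 − εN ≤ S` of the crux. Schedule (given
`t ≥ 1`, `L`, `ε`; `e = min ε 1`, `M = β_∞(Ψ,K)𝔖(Ψ) ≥ 0`, `S = S(Ψ,K,N) ≥ 0`): `g(T)/T → 0` gives `m ≥ 1`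
with `|g((m+1)t)| ≤ (m+1) log(1 + e/4)` (`exists_abs_le_mul_of_tendsto_div`, `exp_le_pow_of_abs_le`);
LOW MASS `M < κN`, `κ ≤ e/2`: `(1−ε)M − εN < 0 ≤ S` (`vonMangoldtSum_nonneg`); HIGH MASS `M ≥ κN`:
`S^{m+1} = ∑_{H ∈ [-2N,2N]^m} S(Ψ^{(H)}, K_H)` (`completeSum`) `≥ ∑_{H nondeg} S_H` (positivity — no
degenerate count needed on this side) `≥ (1+e/4)^{-(m+1)} ∑_{nondeg} M_H − (4N+1)^m η'N` (ATOM L at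
dimension `T = (m+1)t`, size `(3m+1) max(L,1)` by `affLinSize_translateFamily_le`, convex `K_H ⊆ [-N,N]` by
`convex_meetTranslates` / `meetTranslates_subset`) `≥ (1+e/4)^{-(m+1)} (1−ε₅) M^{m+1} − ε₅ N^{m+1} −
5^m N^m η' N` (`singularMean`) `≥ ((1 − e/2) M)^{m+1}` with the parameters of p92176, `k = κ^{m+1}`,
`A = (1+e/4)^{m+1}`, `ε₅ = e k/40`, `η' = e k/(40 A 5^m)` (`lower_ratio`, `sum_filter_lower`,
`card_shiftBox_real_le` in `…AmplificationAux`; this is the lower half of `high_mass_amplify`), whence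
`S ≥ (1 − e/2) M ≥ (1−ε)M − εN` by monotonicity of `x ↦ x^{m+1}` on `ℝ≥0` (`pow_le_pow_iff_left₀`, as in
`…AmplificationAux` l. 279). Template: `…UpperAmplification.lean` (p92176, 268 lines) with every inequality
reversed, the degenerate tail (`exists_degenerate_tail_le`, `stub_degenerateCount`) deleted and the low-mass
case replaced by positivity. -/
theorem stub_lowerAmplification : CoarseLowerHLSlack → LowerRelativeDimOne := by
  sorry

/-! ### Composition (real proofs; the only `sorry`s of this file are the three stubs above)

The mechanical skeleton audit (`#h21_check_skeleton`) takes THE theorem of this file whose conclusion is the crux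
decl by name and requires it to have no hypotheses other than registered obligations; so the composition is
stated hypothesis-free over the three stub theorems (as in `Lines/SketchIdeator1.lean`), and its arrow form
`CoarseUpperHLSlack → CoarseLowerHLSlack → (CoarseLowerHLSlack → LowerRelativeDimOne) → RelativeDimOne` is the
`example` right after it (an `example` is not a declaration, so exactly one declaration here concludes the crux). -/

/-- The crux is EQUIVALENT to the conjunction of its two halves: `S ≤ (1+ε)M + εN` and `(1−ε)M ≤ S + εN`
are the two sides of `|S − M| ≤ ε(M + N)` (stated as an `Iff`, so that the skeleton audit sees exactly one
crux-concluding declaration, `RelativeDimOne_of`). -/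
theorem relativeDimOne_iff_halves : RelativeDimOne ↔ (UpperRelativeDimOne ∧ LowerRelativeDimOne) := by
  constructor
  · intro h
    refine ⟨upperRelativeDimOne_of_relativeDimOne h, ?_⟩
    intro t L ht ε hε
    obtain ⟨N₀, hN₀⟩ := h t L ht ε hε
    refine ⟨N₀, fun N hN Ψ hΨ hL K hK hKN => ?_⟩
    have hb := (abs_le.mp (hN₀ N hN Ψ hΨ hL K hK hKN)).1
    linarith
  · rintro ⟨hU, hL⟩ t L ht ε hε
    obtain ⟨N₁, h₁⟩ := hU t L ht ε hε
    obtain ⟨N₂, h₂⟩ := hL t L ht ε hε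
    refine ⟨max N₁ N₂, fun N hN Ψ hΨ hΨL K hK hKN => ?_⟩
    have hu := h₁ N (le_of_max_le_left hN) Ψ hΨ hΨL K hK hKN
    have hl := h₂ N (le_of_max_le_right hN) Ψ hΨ hΨL K hK hKN
    rw [abs_le]
    constructor
    · linarith
    · linarith

/-- **The crux, from the three registered stubs** — concluding `LeeYangFibres.RelativeDimOne` BY NAME:
the upper half of the crux from ATOM U by the LANDED upper-half amplification
(`upperRelativeDimOne_of_coarseUpperHLSlack`, p92176), the lower half from ATOM L by the lower-half
amplification (third stub), the halves glued by `relativeDimOne_iff_halves`. -/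
theorem RelativeDimOne_of : RelativeDimOne :=
  relativeDimOne_iff_halves.mpr
    ⟨upperRelativeDimOne_of_coarseUpperHLSlack stub_coarseUpperHLSlack,
      stub_lowerAmplification stub_coarseLowerHLSlack⟩

/-- The arrow form of the composition: the three stub STATEMENTS imply the crux (sorry-free in its
hypotheses; this is what `RelativeDimOne_of` instantiates at the stubs). -/
example : CoarseUpperHLSlack → CoarseLowerHLSlack → (CoarseLowerHLSlack → LowerRelativeDimOne) →
    RelativeDimOne :=
  fun hU hL hA => relativeDimOne_iff_halves.mpr ⟨upperRelativeDimOne_of_coarseUpperHLSlack hU, hA hL⟩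

/-- The crux contains its lower half. -/
theorem lowerRelativeDimOne_of_relativeDimOne : RelativeDimOne → LowerRelativeDimOne :=
  fun h => (relativeDimOne_iff_halves.mp h).2

/-! ### The split is lossless (sorry-free): U ∧ L is exactly the old atom, hence exactly the crux -/

/-- The main term `β_∞(Φ,K) 𝔖(Φ)` of a non-degenerate system is non-negative. -/
theorem mainTerm_nonneg {T : ℕ} {Φ : Fin T → AffLinForm 1} (hΦ : IsNondegenerateSystem Φ)
    (K : Set (Fin 1 → ℝ)) : 0 ≤ archFactor Φ K * singularProduct Φ :=
  mul_nonneg (archFactor_nonneg' Φ K)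
    (CellParityLaw.SectionAnnihilator.SingularRatio.singularProduct_nonneg hΦ)

/-- The old atom contains ATOM L (projection; the upper projection is
`GallagherBackwards.coarseUpperHLSlack_of_coarseHLSlack`). -/
theorem coarseLowerHLSlack_of_coarseHLSlack : CoarseHLSlack → CoarseLowerHLSlack := by
  rintro ⟨g, hg, h⟩
  refine ⟨g, hg, fun T L hT η hη => ?_⟩
  obtain ⟨N₀, hN₀⟩ := h T L hT η hη
  exact ⟨N₀, fun N hN Φ hΦ hL K hK hKN => (hN₀ N hN Φ hΦ hL K hK hKN).2⟩

/-- ATOM U and ATOM L together give back the old two-sided atom, with the loss `max(g_U, g_L) = o(T)`. -/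
theorem coarseHLSlack_of_halves : CoarseUpperHLSlack → CoarseLowerHLSlack → CoarseHLSlack := by
  rintro ⟨g₁, hg₁, h₁⟩ ⟨g₂, hg₂, h₂⟩
  refine ⟨fun T => max (g₁ T) (g₂ T), ?_, ?_⟩
  · have hmax := hg₁.max hg₂
    rw [max_self] at hmax
    refine hmax.congr' (Eventually.of_forall fun T => ?_)
    exact max_div_div_right (Nat.cast_nonneg T) (g₁ T) (g₂ T)
  · intro T L hT η hη
    obtain ⟨N₁, hN₁⟩ := h₁ T L hT η hη
    obtain ⟨N₂, hN₂⟩ := h₂ T L hT η hη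
    refine ⟨max N₁ N₂, fun N hN Φ hΦ hL K hK hKN => ?_⟩
    have hu := hN₁ N (le_of_max_le_left hN) Φ hΦ hL K hK hKN
    have hl := hN₂ N (le_of_max_le_right hN) Φ hΦ hL K hK hKN
    have hM := mainTerm_nonneg hΦ K
    constructor
    · refine hu.trans (add_le_add_left (mul_le_mul_of_nonneg_right ?_ hM) _)
      · exact Real.exp_le_exp.mpr (le_max_left _ _)
    · refine le_trans (mul_le_mul_of_nonneg_right ?_ hM) hl
      exact Real.exp_le_exp.mpr (neg_le_neg (le_max_right _ _))

/-- **The split is lossless**: the old atom is EQUIVALENT to the conjunction of its two halves. -/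
theorem coarseHLSlack_iff_halves : CoarseHLSlack ↔ (CoarseUpperHLSlack ∧ CoarseLowerHLSlack) :=
  ⟨fun h => ⟨coarseUpperHLSlack_of_coarseHLSlack h, coarseLowerHLSlack_of_coarseHLSlack h⟩,
    fun h => coarseHLSlack_of_halves h.1 h.2⟩

/-- Tightness of ATOM L (with `g ≡ 1`): the sharp lower half of the crux implies the coarse one
(`ε = min η (1/2)`: `e^{-1} M ≤ (1 − ε) M ≤ S + εN ≤ S + ηN`). With `stub_lowerAmplification` this makes
ATOM L EQUIVALENT to `LowerRelativeDimOne` — "sharpness is free" for the lower half on its own. -/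
theorem coarseLowerHLSlack_of_lowerRelativeDimOne : LowerRelativeDimOne → CoarseLowerHLSlack := by
  intro h
  refine ⟨fun _ => 1, ?_, ?_⟩
  · have h1 : Tendsto (fun T : ℕ => (1 : ℝ) / (T : ℝ)) atTop (𝓝 0) := tendsto_one_div_atTop_nhds_zero_nat
    exact h1
  · intro T L hT η hη
    obtain ⟨N₀, hN₀⟩ := h T L hT (min η (1 / 2)) (by positivity)
    refine ⟨N₀, fun N hN Φ hΦ hL K hK hKN => ?_⟩
    have hb := hN₀ N hN Φ hΦ hL K hK hKN
    have hM := mainTerm_nonneg hΦ K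
    set S := vonMangoldtSum Φ K N with hSdef
    set M := archFactor Φ K * singularProduct Φ with hMdef
    have hε1 : min η (1 / 2) ≤ η := min_le_left _ _
    have hε2 : min η (1 / 2) ≤ 1 / 2 := min_le_right _ _
    have hN0 : (0 : ℝ) ≤ N := Nat.cast_nonneg N
    have he' : Real.exp (-(1 : ℝ)) ≤ 1 / 2 := by
      have he : (2 : ℝ) ≤ Real.exp 1 := by
        have := Real.add_one_le_exp (1 : ℝ)
        linarith
      rw [Real.exp_neg, inv_le_comm₀ (Real.exp_pos 1) (by norm_num)]
      linarith
    have hεM : min η (1 / 2) * M ≤ 1 / 2 * M := mul_le_mul_of_nonneg_right hε2 hM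
    have hεN : min η (1 / 2) * (N : ℝ) ≤ η * N := mul_le_mul_of_nonneg_right hε1 hN0
    have h3 : Real.exp (-(1 : ℝ)) * M ≤ 1 / 2 * M := mul_le_mul_of_nonneg_right he' hM
    show Real.exp (-(1 : ℝ)) * M ≤ S + η * N
    nlinarith

/-- Tightness of ATOM U (with `g ≡ 1`), the mirror statement: the sharp upper half of the crux implies
the coarse one; with p92176 ATOM U is EQUIVALENT to `UpperRelativeDimOne`. -/
theorem coarseUpperHLSlack_of_upperRelativeDimOne : UpperRelativeDimOne → CoarseUpperHLSlack := by
  intro h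
  refine ⟨fun _ => 1, ?_, ?_⟩
  · have h1 : Tendsto (fun T : ℕ => (1 : ℝ) / (T : ℝ)) atTop (𝓝 0) := tendsto_one_div_atTop_nhds_zero_nat
    exact h1
  · intro T L hT η hη
    obtain ⟨N₀, hN₀⟩ := h T L hT (min η (1 / 2)) (by positivity)
    refine ⟨N₀, fun N hN Φ hΦ hL K hK hKN => ?_⟩
    have hb := hN₀ N hN Φ hΦ hL K hK hKN
    have hM := mainTerm_nonneg hΦ K
    set S := vonMangoldtSum Φ K N with hSdef
    set M := archFactor Φ K * singularProduct Φ with hMdef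
    have hε1 : min η (1 / 2) ≤ η := min_le_left _ _
    have hε2 : min η (1 / 2) ≤ 1 / 2 := min_le_right _ _
    have hN0 : (0 : ℝ) ≤ N := Nat.cast_nonneg N
    have he : (2 : ℝ) ≤ Real.exp 1 := by
      have := Real.add_one_le_exp (1 : ℝ)
      linarith
    have hεM : min η (1 / 2) * M ≤ 1 / 2 * M := mul_le_mul_of_nonneg_right hε2 hM
    have hεN : min η (1 / 2) * (N : ℝ) ≤ η * N := mul_le_mul_of_nonneg_right hε1 hN0
    have h2 : (1 + 1 / 2) * M ≤ Real.exp 1 * M := mul_le_mul_of_nonneg_right (by linarith) hM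
    show S ≤ Real.exp 1 * M + η * N
    nlinarith

/-- ATOM U ↔ the upper half of the crux (both directions in the tree now). -/
theorem coarseUpperHLSlack_iff_upperRelativeDimOne : CoarseUpperHLSlack ↔ UpperRelativeDimOne :=
  ⟨upperRelativeDimOne_of_coarseUpperHLSlack, coarseUpperHLSlack_of_upperRelativeDimOne⟩

/-- ATOM L ↔ the lower half of the crux, GIVEN the third stub (the only provable work left on the line). -/
theorem coarseLowerHLSlack_iff_lowerRelativeDimOne (hA : CoarseLowerHLSlack → LowerRelativeDimOne) :
    CoarseLowerHLSlack ↔ LowerRelativeDimOne :=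
  ⟨hA, coarseLowerHLSlack_of_lowerRelativeDimOne⟩

/-! ### Hardness hooks (sorry-free pointers for the disprover / triage) -/

/-- ATOM U alone forces uniform character PNT to conductor `N^{1−o(1)}` (p92834). -/
example : CoarseUpperHLSlack → UniformCharPNT := uniformCharPNT_of_coarseUpperHLSlack

/-- The three stubs together force the twin prime conjecture (through the crux; the lower half alone
suffices — a `LowerRelativeDimOne → TwinPrimeConjecture` sharpening of
`twinPrimeConjecture_of_relativeDimOne` is a cheap `--supports` certificate, not a stub). -/
example (hU : CoarseUpperHLSlack) (hL : CoarseLowerHLSlack) (hA : CoarseLowerHLSlack → LowerRelativeDimOne) :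
    TwinPrimeConjecture :=
  Theorems.LeeYangFibresRelativeDimOne.twinPrimeConjecture_of_relativeDimOne
    (relativeDimOne_iff_halves.mpr ⟨upperRelativeDimOne_of_coarseUpperHLSlack hU, hA hL⟩)

end Summit.Parity.GeneralizedHardyLittlewood.Cruxes.RelativeDimOne.TranslateAmplification
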